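import Summits.RiemannHypothesis.RiemannHypothesis.Theses.NymanBeurling
import Literature.NumberTheory.LFunctions.BaezDuarteLowerBound
import Literature.NumberTheory.LFunctions.NymanBeurlingDirichlet
import Literature.Analysis.FunctionSpaces.PlancherelL1L2

/-!
# Route NymanBeurling — the unconditional floor under the thesis `NbThesis`, in its own terms

Route `RiemannHypothesis/NymanBeurling`, target `NbThesis` (stmt-RiemannHypothesis-0392): for
every `ε > 0` some Dirichlet polynomial `A(s) = Σ_{k<N} a_k (k+1)^{-s}` (complex coefficients) has
`∫_ℝ |1 - ζ(1/2+it) A(1/2+it)|² dt/(1/4+t²) < ε`.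

The Báez-Duarte–Balazard–Landreau–Saias lower bound is proved in the tree in FUNCTION-SPACE form
with REAL coefficients (`Literature.NumberTheory.LFunctions.BaezDuarteU.lowerBound_real`:
`‖χ - Σ c_k ρ_{a_k}‖_{L²(0,∞)} ≥ C₀/√log N` for real `c_k` and dilations `1 ≤ a_k ≤ N`). This file
transports it to the EXACT integrand shared by the route's items `NbThesis`, `NbRateLog`,
`NbMoebiusMollifier` (critical line, complex coefficients, weight `1/(1/4+t²)`, `∫⁻`):

* `nbIntegrand_lowerBound` — there is an absolute `C > 0` with
  `ENNReal.ofReal (C / log (max N 2)) ≤ ∫⁻ |1 - ζA|²/(1/4+t²)` for EVERY `N` and EVERY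
  `a : Fin N → ℂ`. Mechanism: `(1 - ζ(s)A(s))/s` is the Mellin transform of
  `g = χ + Σ a_k ρ_{k+1}` (`M[χ] = 1/s`, `M[ρ_a] = -a^{-s}ζ(s)/s`), so by Mellin–Plancherel
  (`Literature.Analysis.FunctionSpaces.integral_norm_sq_mellin_half_eq`) the integral is
  `2π‖g‖²₂ ≥ 2π‖Re g‖²₂`, and `Re g = χ - Σ (-Re a_k) ρ_{k+1}` is a real Beurling combination with
  dilations `≤ max N 2`.
* `nbIntegrand_lowerBound_two_le` — the same for `N ≥ 2` with `log N`, i.e. literally the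
  left-hand side of crux #2 `NbRateLog` reversed: the order `1/log N` asked there cannot be
  improved, and any admissible constant in `NbRateLog` is `≥ C` (`le_const_of_nbRateBound`).
* `exp_lt_of_nbWitness` — **cost of a witness of the thesis**: if `(N, a)` achieves
  `∫⁻ … < ε` then `exp (C/ε) < max N 2`. So `NbThesis` (⟺ RH, `nbThesis_iff`) admits no finite
  certificate: an `ε`-witness needs `N > exp(C/ε)` terms.

No definitions. References: Báez-Duarte, Balazard, Landreau, Saias, Adv. Math. 149 (2000)
(the bound); Báez-Duarte, Rend. Lincei 14 (2003) §1 (1.3) (as printed) and §2.2 (2.4) (the Mellin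
transform of the approximant); Burnol, Adv. Math. 170 (2002) §3 (Mellin–Plancherel isometry).
-/

noncomputable section

open Complex MeasureTheory Set Filter
open scoped Real ENNReal

namespace Summit.RiemannHypothesis.RiemannHypothesis.Theorems

open Summit.RiemannHypothesis.RiemannHypothesis.Theses.NymanBeurling
open Literature.NumberTheory.LFunctions Literature.NumberTheory.LFunctions.BaezDuarteU

/-- The natural dilations `k + 1`, `k < N`, satisfy `1 ≤ k+1 ≤ max N 2`. [folklore] -/
theorem natDilation_le_max (N : ℕ) (k : Fin N) :
    1 ≤ ((k : ℕ) : ℝ) + 1 ∧ ((k : ℕ) : ℝ) + 1 ≤ max (N : ℝ) 2 := by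
  refine ⟨by simp, le_trans ?_ (le_max_left _ _)⟩
  exact_mod_cast Nat.succ_le_of_lt k.isLt

/-- For real `u, v, w`: `|u|² ≤ |u + i(v - w)|²`. [folklore] -/
theorem norm_sq_ofReal_le (u v w : ℝ) :
    ‖(u : ℂ)‖ ^ 2 ≤ ‖(u : ℂ) + I * ((v : ℂ) - (w : ℂ))‖ ^ 2 := by
  have h1 : (u : ℂ) + I * ((v : ℂ) - (w : ℂ)) = (u : ℝ) + ((v - w : ℝ)) * I := by push_cast; ring
  rw [h1, Complex.sq_norm, Complex.sq_norm, Complex.normSq_add_mul_I, Complex.normSq_ofReal]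
  nlinarith [sq_nonneg (v - w)]

/-- **Mellin transform of the complex-coefficient approximant.** For `a : Fin N → ℂ` and
`0 < Re s < 1`, the function `g = f_{x} + i (f_0 - f_{y})` built from the tree's real approximants
`f_c = χ - Σ c_k ρ_{k+1}` (`nbFun`) with `x = -Re a`, `y = Im a` — that is, `g = χ + Σ a_k ρ_{k+1}` —
has `M[g](s) = (1 - ζ(s) Σ a_k (k+1)^{-s})/s`. [cite: BaezDuarte2003, §2.2 (2.4)] -/
theorem hasMellin_nbComplexApprox {N : ℕ} (a : Fin N → ℂ) {s : ℂ} (hs0 : 0 < s.re) (hs1 : s.re < 1) :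
    HasMellin (fun t : ℝ ↦ nbFun (fun k : Fin N ↦ ((k : ℕ) : ℝ) + 1) (fun j ↦ -(a j).re) t +
        I * (nbFun (fun k : Fin N ↦ ((k : ℕ) : ℝ) + 1) (fun _ ↦ (0 : ℝ)) t -
          nbFun (fun k : Fin N ↦ ((k : ℕ) : ℝ) + 1) (fun j ↦ (a j).im) t)) s
      ((1 - riemannZeta s * ∑ n : Fin N, a n * (((n : ℕ) : ℂ) + 1) ^ (-s)) / s) := by
  set d : Fin N → ℝ := fun k ↦ ((k : ℕ) : ℝ) + 1 with hd
  have hd0 : ∀ j, 0 < d j := fun j ↦ by simp only [hd]; positivity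
  have hx := hasMellin_nbFun d (fun j ↦ -(a j).re) hd0 hs0 hs1
  have h0 := hasMellin_nbFun d (fun _ ↦ (0 : ℝ)) hd0 hs0 hs1
  have hy := hasMellin_nbFun d (fun j ↦ (a j).im) hd0 hs0 hs1
  have h := hx.add ((h0.sub hy).const_mul I)
  refine ⟨h.1, h.2.trans ?_⟩
  -- the algebra of the Mellin values
  have hP0 : dirichletSum d (fun _ ↦ (0 : ℝ)) s = 0 := by simp [dirichletSum]
  have hP : dirichletSum d (fun j ↦ -(a j).re) s - I * dirichletSum d (fun j ↦ (a j).im) s =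
      -∑ n : Fin N, a n * (((n : ℕ) : ℂ) + 1) ^ (-s) := by
    simp only [dirichletSum, hd, Finset.mul_sum, ← Finset.sum_sub_distrib, ← Finset.sum_neg_distrib]
    refine Finset.sum_congr rfl fun j _ ↦ ?_
    have hj : (a j : ℂ) = ((a j).re : ℂ) + ((a j).im : ℂ) * I := (re_add_im (a j)).symm
    push_cast
    linear_combination (-((((j : ℕ) : ℂ) + 1) ^ (-s))) * hj.symm
  have hs : s ≠ 0 := fun h ↦ by simp [h] at hs0
  rw [hP0, mul_zero, add_zero]
  rw [show (1 + riemannZeta s * dirichletSum d (fun j ↦ -(a j).re) s) / s +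
      I * (1 / s - (1 + riemannZeta s * dirichletSum d (fun j ↦ (a j).im) s) / s) =
      (1 + riemannZeta s * (dirichletSum d (fun j ↦ -(a j).re) s -
        I * dirichletSum d (fun j ↦ (a j).im) s)) / s by field_simp; ring]
  rw [hP]
  ring

/-- **The BDBLS floor in the route's own integrand.** There is an absolute constant `C > 0` such
that for every `N` and every `a : Fin N → ℂ`,
`C / log (max N 2) ≤ ∫_ℝ |1 - ζ(1/2+it) Σ_{k<N} a_k (k+1)^{-(1/2+it)}|² dt/(1/4+t²)`
(as an inequality in `ℝ≥0∞` for the lower Lebesgue integral used by the route's items).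
Mellin–Plancherel turns the integral into `2π ‖χ + Σ a_k ρ_{k+1}‖²_{L²(0,∞)}`, which dominates
`2π ‖χ - Σ (-Re a_k) ρ_{k+1}‖²`, bounded below by `lowerBound_real` with dilation bound `max N 2`.
[cite: BDBLS2000, main theorem] [cite: BaezDuarte2003, §1 (1.3)] -/
theorem nbIntegrand_lowerBound : ∃ C : ℝ, 0 < C ∧ ∀ (N : ℕ) (a : Fin N → ℂ),
    ENNReal.ofReal (C / Real.log (max (N : ℝ) 2)) ≤
      ∫⁻ t : ℝ, ENNReal.ofReal (‖1 - riemannZeta (1 / 2 + t * Complex.I) *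
        ∑ n : Fin N, a n * ((n : ℂ) + 1) ^ (-(1 / 2 + t * Complex.I))‖ ^ 2 / (1 / 4 + t ^ 2)) := by
  obtain ⟨C₀, hC₀, hlb⟩ := lowerBound_real
  refine ⟨2 * π * C₀ ^ 2, by positivity, fun N a ↦ ?_⟩
  set d : Fin N → ℝ := fun k ↦ ((k : ℕ) : ℝ) + 1 with hd
  have hd1 : ∀ j, 1 ≤ d j := fun j ↦ (natDilation_le_max N j).1
  set x : Fin N → ℝ := fun j ↦ -(a j).re with hx
  set y : Fin N → ℝ := fun j ↦ (a j).im with hy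
  set g : ℝ → ℂ := fun t ↦ nbFun d x t + I * (nbFun d (fun _ ↦ (0 : ℝ)) t - nbFun d y t) with hg
  -- `g ∈ L²`, `M[g]` converges on the critical line
  have hgL2 : MemLp g 2 (volume.restrict (Ioi (0 : ℝ))) :=
    (memLp_two_nbFun d x hd1).add
      (((memLp_two_nbFun d _ hd1).sub (memLp_two_nbFun d y hd1)).const_mul I)
  have hg2 : IntegrableOn (fun t ↦ ‖g t‖ ^ 2) (Ioi 0) :=
    (memLp_two_iff_integrable_sq_norm hgL2.1).1 hgL2
  have hgM : MellinConvergent g (1 / 2) :=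
    (hasMellin_nbComplexApprox a (s := 1 / 2) (by norm_num) (by norm_num)).1
  obtain ⟨hint, hP⟩ := Literature.Analysis.FunctionSpaces.integral_norm_sq_mellin_half_eq hgM hg2
  -- the integrand is `‖M[g](1/2+it)‖²`
  have hpt : ∀ t : ℝ, ‖1 - riemannZeta (1 / 2 + t * Complex.I) *
      ∑ n : Fin N, a n * ((n : ℂ) + 1) ^ (-(1 / 2 + t * Complex.I))‖ ^ 2 / (1 / 4 + t ^ 2) =
      ‖mellin g (1 / 2 + t * I)‖ ^ 2 := by
    intro t
    rw [(hasMellin_nbComplexApprox a (s := 1 / 2 + t * I) (by simp) (by simp; norm_num)).2,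
      norm_div, div_pow, norm_sq_one_half_add]
  -- the real lower bound, squared
  have hxlb := hlb N d x (max (N : ℝ) 2) (natDilation_le_max N) (le_max_right _ _)
  have hlog : 0 < Real.log (max (N : ℝ) 2) :=
    Real.log_pos (lt_of_lt_of_le (by norm_num) (le_max_right _ _))
  have hI0 : 0 ≤ ∫ t in Ioi (0 : ℝ), ‖nbFun d x t‖ ^ 2 := integral_nonneg fun _ ↦ by positivity
  have hsq : C₀ ^ 2 / Real.log (max (N : ℝ) 2) ≤ ∫ t in Ioi (0 : ℝ), ‖nbFun d x t‖ ^ 2 := by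
    have h1 : 0 ≤ C₀ / Real.sqrt (Real.log (max (N : ℝ) 2)) := by positivity
    have h2 := pow_le_pow_left₀ h1 hxlb 2
    rw [div_pow, Real.sq_sqrt hlog.le, Real.sq_sqrt hI0] at h2
    exact h2
  -- `‖Re g‖² ≤ ‖g‖²` pointwise, hence in `L²`
  have hmono : ∫ t in Ioi (0 : ℝ), ‖nbFun d x t‖ ^ 2 ≤ ∫ t in Ioi (0 : ℝ), ‖g t‖ ^ 2 := by
    refine integral_mono (integrableOn_norm_sq_nbFun d x hd1) hg2 fun t ↦ ?_
    exact norm_sq_ofReal_le _ _ _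
  -- assemble
  calc ENNReal.ofReal (2 * π * C₀ ^ 2 / Real.log (max (N : ℝ) 2))
      ≤ ENNReal.ofReal (2 * π * ∫ t in Ioi (0 : ℝ), ‖g t‖ ^ 2) := by
        refine ENNReal.ofReal_le_ofReal ?_
        rw [mul_div_assoc]
        exact mul_le_mul_of_nonneg_left (hsq.trans hmono) (by positivity)
    _ = ENNReal.ofReal (∫ τ : ℝ, ‖mellin g (1 / 2 + τ * I)‖ ^ 2) := by rw [hP]
    _ = ∫⁻ τ : ℝ, ENNReal.ofReal (‖mellin g (1 / 2 + τ * I)‖ ^ 2) :=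
        ofReal_integral_eq_lintegral_ofReal hint (Eventually.of_forall fun _ ↦ by positivity)
    _ = _ := lintegral_congr fun t ↦ by rw [hpt t]

/-- The floor for `N ≥ 2` in the exact shape of crux #2 `NbRateLog` (which asks for the reverse
inequality `≤ C'/log N` with some witness `a`): the order `1/log N` is optimal.
[cite: BDBLS2000, main theorem] [cite: BaezDuarte2003, §1 (1.3)] -/
theorem nbIntegrand_lowerBound_two_le : ∃ C : ℝ, 0 < C ∧ ∀ (N : ℕ), 2 ≤ N → ∀ a : Fin N → ℂ,
    ENNReal.ofReal (C / Real.log N) ≤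
      ∫⁻ t : ℝ, ENNReal.ofReal (‖1 - riemannZeta (1 / 2 + t * Complex.I) *
        ∑ n : Fin N, a n * ((n : ℂ) + 1) ^ (-(1 / 2 + t * Complex.I))‖ ^ 2 / (1 / 4 + t ^ 2)) := by
  obtain ⟨C, hC, h⟩ := nbIntegrand_lowerBound
  refine ⟨C, hC, fun N hN a ↦ ?_⟩
  have hmax : max (N : ℝ) 2 = N := max_eq_left (by exact_mod_cast hN)
  simpa only [hmax] using h N a

/-- **Any admissible constant in `NbRateLog` is at least the BDBLS constant**: if `C'` works in
crux #2 (for every `N ≥ 2` some length-`N` polynomial has integral `≤ C'/log N`), then `C ≤ C'`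
for the constant `C > 0` of `nbIntegrand_lowerBound_two_le`. In particular `NbRateLog` cannot be
strengthened to `o(1/log N)`. [cite: Burnol2002, Thm. 1.2] -/
theorem le_const_of_nbRateBound : ∃ C : ℝ, 0 < C ∧ ∀ C' : ℝ,
    (∀ N : ℕ, 2 ≤ N → ∃ a : Fin N → ℂ, ∫⁻ t : ℝ, ENNReal.ofReal (‖1 - riemannZeta (1 / 2 + t * Complex.I) *
        ∑ n : Fin N, a n * ((n : ℂ) + 1) ^ (-(1 / 2 + t * Complex.I))‖ ^ 2 / (1 / 4 + t ^ 2)) ≤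
      ENNReal.ofReal (C' / Real.log N)) → C ≤ C' := by
  obtain ⟨C, hC, h⟩ := nbIntegrand_lowerBound_two_le
  refine ⟨C, hC, fun C' hC' ↦ ?_⟩
  obtain ⟨a, ha⟩ := hC' 2 le_rfl
  have h2 := (h 2 le_rfl a).trans ha
  have hlog : 0 < Real.log ((2 : ℕ) : ℝ) := Real.log_pos (by norm_num)
  by_contra hlt
  push Not at hlt
  have hpos : 0 < C / Real.log ((2 : ℕ) : ℝ) := div_pos hC hlog
  have : C / Real.log ((2 : ℕ) : ℝ) ≤ C' / Real.log ((2 : ℕ) : ℝ) := by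
    by_cases hC'0 : 0 ≤ C' / Real.log ((2 : ℕ) : ℝ)
    · exact (ENNReal.ofReal_le_ofReal_iff hC'0).1 h2
    · push Not at hC'0
      rw [ENNReal.ofReal_of_nonpos hC'0.le, nonpos_iff_eq_zero, ENNReal.ofReal_eq_zero] at h2
      linarith
  rw [div_le_div_iff_of_pos_right hlog] at this
  linarith

/-- **Cost of a witness of the thesis.** With the constant `C > 0` of `nbIntegrand_lowerBound`:
if `(N, a)` witnesses the `ε`-clause of `NbThesis`, then `exp (C/ε) < max N 2`. Hence an
`ε`-approximation needs more than `exp (C/ε)` terms, and no finite computation certifies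
`NbThesis`. [cite: BaezDuarte2003, §1 (1.3)] -/
theorem exp_lt_of_nbWitness : ∃ C : ℝ, 0 < C ∧ ∀ (ε : ℝ), 0 < ε → ∀ (N : ℕ) (a : Fin N → ℂ),
    (∫⁻ t : ℝ, ENNReal.ofReal (‖1 - riemannZeta (1 / 2 + t * Complex.I) *
        ∑ n : Fin N, a n * ((n : ℂ) + 1) ^ (-(1 / 2 + t * Complex.I))‖ ^ 2 / (1 / 4 + t ^ 2)) <
      ENNReal.ofReal ε) → Real.exp (C / ε) < max (N : ℝ) 2 := by
  obtain ⟨C, hC, h⟩ := nbIntegrand_lowerBound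
  refine ⟨C, hC, fun ε hε N a hlt ↦ ?_⟩
  have hmax : (0 : ℝ) < max (N : ℝ) 2 := lt_of_lt_of_le (by norm_num) (le_max_right _ _)
  have hlog : 0 < Real.log (max (N : ℝ) 2) :=
    Real.log_pos (lt_of_lt_of_le (by norm_num) (le_max_right _ _))
  have h1 : ENNReal.ofReal (C / Real.log (max (N : ℝ) 2)) < ENNReal.ofReal ε :=
    lt_of_le_of_lt (h N a) hlt
  rw [ENNReal.ofReal_lt_ofReal_iff hε] at h1
  have h2 : C / ε < Real.log (max (N : ℝ) 2) := by
    rw [div_lt_iff₀ hε]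
    rw [div_lt_iff₀ hlog] at h1
    linarith [mul_comm ε (Real.log (max (N : ℝ) 2))]
  calc Real.exp (C / ε) < Real.exp (Real.log (max (N : ℝ) 2)) := Real.exp_lt_exp.2 h2
    _ = max (N : ℝ) 2 := Real.exp_log hmax

end Summit.RiemannHypothesis.RiemannHypothesis.Theorems

end
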